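import Literature.NumberTheory.Automorphic.CentralEigensystemGrossencharakter
import Literature.NumberTheory.GaloisRepresentations.GrossencharakterIdeleValue
import HarnessLib

/-!
# The central Hecke eigensystem is a Größencharakter (complex form)

Topic `NumberTheory/Automorphic`; namespace `Literature.NumberTheory.Automorphic.ParallelWeight`.
Theorems only.

Transport of `CentralEigensystemGrossencharakter.centralEigensystem_idealPow_mul_eq` through a field
isomorphism `ι : E ≃+* ℂ`: for a class `ξ ≠ 0` in `H^q(X_U, Ṽ_wt(E))` with central eigenvalues
`a(w)` off a finite set `S` and `K_f(𝔫) ≤ U`, the function `w ↦ ι (a w)` is an algebraic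
Größencharakter (`Literature.NumberTheory.GaloisRepresentations.IsGrossencharakter`) of conductor
dividing `𝔫 · ∏_{w ∈ S} w` and infinity type `(M, (mult w - 1)·M)`, `M = n · lowest(wt) + deg(wt)`
(`isGrossencharakter_centralEigensystem`).  Ingredients: `ι (A(x)) = idealPow (ι ∘ a) (x)`
(`map_eigenvalueProd`), `ι (ω_wt(x)) = ∏_{σ : F → ℂ} σ(x)^M` (`map_centralWeight`), and the
fibrewise decomposition `∏_{σ} σ(x)^M = ∏_{w ∣ ∞} w(x)^M · conj(w(x))^{(mult w - 1) M}`
(`prod_embeddings_eq_prod_infinitePlace`, Mathlib `InfinitePlace.card_filter_mk_eq`).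
[cite: Harder1987, §2]

## References

* G. Harder, *Eisenstein cohomology of arithmetic groups. The case GL₂*, Invent. Math. 89 (1987), §2
  [Harder1987].
* J. Neukirch, *Algebraic Number Theory* (1999), Ch. VII §6 [NeukirchANT1999].
-/

noncomputable section

open scoped NumberField ComplexConjugate
open IsDedekindDomain NumberField

namespace Literature.NumberTheory.Automorphic.ParallelWeight

open BigHeckeGLn Literature.NumberTheory.GaloisRepresentations

/-! ### Products over complex embeddings, fibrewise over infinite places -/

section Embeddings

variable {K : Type*} [Field K] [NumberField K]

/-- **Fibrewise decomposition of a product over the complex embeddings**: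
`∏_σ f(σ) = ∏_w f(σ_w) · f(σ̄_w)^{mult(w) - 1}`. [folklore] -/
theorem prod_embeddings_eq_prod_infinitePlace {α : Type*} [CommMonoid α] (f : (K →+* ℂ) → α) :
    ∏ φ : K →+* ℂ, f φ =
      ∏ w : InfinitePlace K, f w.embedding * f (ComplexEmbedding.conjugate w.embedding) ^ (w.mult - 1) := by
  classical
  rw [← Finset.prod_fiberwise Finset.univ InfinitePlace.mk f]
  refine Finset.prod_congr rfl fun w _ => ?_
  have hset : (Finset.univ.filter fun φ : K →+* ℂ => InfinitePlace.mk φ = w) =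
      {w.embedding, ComplexEmbedding.conjugate w.embedding} := by
    ext φ
    rw [Finset.mem_filter, Finset.mem_insert, Finset.mem_singleton]
    simp only [Finset.mem_univ, true_and]
    constructor
    · intro h
      rw [← InfinitePlace.mk_embedding w, InfinitePlace.mk_eq_iff] at h
      rcases h with h | h
      · exact Or.inl h
      · right
        rw [← h]
        exact (star_involutive φ).symm
    · rintro (h | h)
      · rw [h, InfinitePlace.mk_embedding]
      · rw [h, InfinitePlace.mk_conjugate_eq, InfinitePlace.mk_embedding]
  rw [hset, InfinitePlace.mult]
  by_cases hw : w.IsReal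
  · rw [InfinitePlace.conjugate_embedding_eq_of_isReal hw, Finset.insert_eq_of_mem (Finset.mem_singleton_self _),
      Finset.prod_singleton, if_pos hw, Nat.sub_self, pow_zero, mul_one]
  · rw [Finset.prod_pair, if_neg hw, show 2 - 1 = 1 from rfl, pow_one]
    intro h
    exact hw (InfinitePlace.isReal_iff.2 (ComplexEmbedding.isReal_iff.2 h.symm))

/-- `∏_σ σ(x)^M = ∏_w w(x)^M · conj(w(x))^{(mult(w) - 1) M}`. [folklore] -/
theorem prod_embeddings_zpow (x : K) (M : ℤ) :
    ∏ φ : K →+* ℂ, φ x ^ M =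
      ∏ w : InfinitePlace K, w.embedding x ^ M * conj (w.embedding x) ^ (((w.mult - 1 : ℕ) : ℤ) * M) := by
  rw [prod_embeddings_eq_prod_infinitePlace]
  refine Finset.prod_congr rfl fun w _ => ?_
  rw [mul_comm (((w.mult - 1 : ℕ) : ℤ)) M, zpow_mul, zpow_natCast]
  rfl

end Embeddings

/-! ### Transport through `ι : E ≃+* ℂ` -/

variable {E : Type} [Field E] {F : Type} [Field F] [NumberField F] {n : ℕ} {wt : Fin n → ℤ}
  {U : Subgroup (BigHeckeGLn.FiniteAdelicGL n F)} {q : ℕ}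

/-- `ι (A(x)) = idealPow (ι ∘ a) (x)`. [folklore] -/
theorem map_eigenvalueProd {G : Type*} [FunLike G E ℂ] [RingHomClass G E ℂ] (ι : G)
    (a : HeightOneSpectrum (𝓞 F) → E) (x : 𝓞 F) (hx : x ≠ 0) :
    ι (eigenvalueProd a x hx) = LFunctions.idealPow F (fun w => ι (a w)) (Ideal.span {x}) := by
  classical
  have hI : Ideal.span {x} ≠ 0 := by rw [Ne, Ideal.zero_eq_bot, Ideal.span_singleton_eq_bot]; exact hx
  rw [eigenvalueProd, Finset.prod_map_toList, map_prod, LFunctions.idealPow,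
    finprod_eq_prod_of_mulSupport_subset _ (s := (Ideal.finite_factors hI).toFinset)]
  · refine Finset.prod_congr rfl fun w _ => ?_
    rw [map_pow]; rfl
  · intro w hw
    rw [Function.mem_mulSupport] at hw
    rw [Finset.mem_coe, Set.Finite.mem_toFinset]
    by_contra h
    have h0 : (Associates.mk w.asIdeal).count (Associates.mk (Ideal.span {x})).factors = 0 := by
      by_contra h'
      exact h ((Associates.count_ne_zero_iff_dvd hI w.irreducible).mp h')
    exact hw (by rw [h0, pow_zero])

variable [CharZero E]

/-- The integer exponent `M = n · lowest(wt) + deg(wt)` of the central character. [folklore] -/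
abbrev centralExponent (n : ℕ) (wt : Fin n → ℤ) : ℤ :=
  (n : ℤ) * GLnCohomology.lowestEntry wt + GLnCohomology.coeffDegree wt

/-- Composition with `ι` is a bijection `(F →+* E) ≃ (F →+* ℂ)`. [folklore] -/
def embEquiv (ι : E ≃+* ℂ) : (F →+* E) ≃ (F →+* ℂ) where
  toFun τ := ι.toRingHom.comp τ
  invFun σ := ι.symm.toRingHom.comp σ
  left_inv τ := by ext; simp
  right_inv σ := by ext; simp

/-- `ι (ω_wt(x)) = ∏_{σ : F → ℂ} σ(x)^M`. [folklore] -/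
theorem map_centralWeight (ι : E ≃+* ℂ) (x : Fˣ) :
    ι (centralWeight (E := E) n wt x) = ∏ σ : F →+* ℂ, σ (x : F) ^ centralExponent n wt := by
  rw [centralWeight, map_prod]
  refine Fintype.prod_equiv (embEquiv ι) _ _ fun τ => ?_
  have hτ : (embEquiv (F := F) ι τ) (x : F) = ι (τ x) := rfl
  have h0 : ι (τ (x : F)) ≠ 0 := by
    rw [map_ne_zero, map_ne_zero]; exact x.ne_zero
  rw [hτ, map_mul, map_pow, centralExponent, zpow_add₀ h0, zpow_mul, zpow_natCast, zpow_natCast]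
  congr 1
  rw [Units.val_zpow_eq_zpow_val, map_zpow₀, Units.val_pow_eq_pow_val, map_pow, Units.coe_map,
    MonoidHom.coe_coe]

/-- The conductor-type ideal `𝔫 · ∏_{w ∈ S} w`. [folklore] -/
abbrev conductorOf (𝔫 : Ideal (𝓞 F)) {S : Set (HeightOneSpectrum (𝓞 F))} (hS : S.Finite) : Ideal (𝓞 F) :=
  𝔫 * ∏ w ∈ hS.toFinset, w.asIdeal

omit [NumberField F] in
/-- `𝔫 · ∏_S w ≠ 0`. [folklore] -/
theorem conductorOf_ne_bot {𝔫 : Ideal (𝓞 F)} (h𝔫 : 𝔫 ≠ 0)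
    {S : Set (HeightOneSpectrum (𝓞 F))} (hS : S.Finite) : conductorOf 𝔫 hS ≠ ⊥ := by
  rw [Ne, ← Ideal.zero_eq_bot, mul_eq_zero, not_or]
  exact ⟨h𝔫, Finset.prod_ne_zero_iff.2 fun w _ => by simpa using w.ne_bot⟩

omit [NumberField F] in
/-- A prime `w` with `¬ 𝔣 ≤ w` is outside `S` and prime to `𝔫`. [folklore] -/
theorem not_mem_and_not_dvd_of_not_le {𝔫 : Ideal (𝓞 F)} {S : Set (HeightOneSpectrum (𝓞 F))}
    (hS : S.Finite) {w : HeightOneSpectrum (𝓞 F)} (hw : ¬ conductorOf 𝔫 hS ≤ w.asIdeal) :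
    w ∉ S ∧ ¬ w.asIdeal ∣ 𝔫 := by
  constructor
  · intro hwS
    apply hw
    refine Ideal.mul_le_left.trans (Ideal.le_of_dvd ?_)
    exact Finset.dvd_prod_of_mem _ (hS.mem_toFinset.2 hwS)
  · intro hd
    exact hw (Ideal.mul_le_right.trans (Ideal.le_of_dvd hd))

omit [NumberField F] in
/-- Prime factors of an element coprime to `𝔣` avoid `𝔣`. [folklore] -/
theorem not_le_of_dvd_span_of_isCoprime {𝔣 : Ideal (𝓞 F)} {c : 𝓞 F}
    (hc : IsCoprime (Ideal.span {c}) 𝔣) {w : HeightOneSpectrum (𝓞 F)} (hw : w.asIdeal ∣ Ideal.span {c}) :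
    ¬ 𝔣 ≤ w.asIdeal := by
  intro hle
  have htop : Ideal.span {c} ⊔ 𝔣 = ⊤ := Ideal.isCoprime_iff_sup_eq.1 hc
  have : Ideal.span {c} ⊔ 𝔣 ≤ w.asIdeal := sup_le (Ideal.le_of_dvd hw) hle
  rw [htop, top_le_iff] at this
  exact w.isPrime.ne_top this

/-- **The central eigensystem is an algebraic Größencharakter.**  For `ξ ≠ 0` in
`H^q(X_U, Ṽ_wt(E))` with `T_{w,n} ξ = a(w) ξ` for `w ∉ S` (`S` finite) and `K_f(𝔫) ≤ U`, the
function `w ↦ ι (a w)` is a Größencharakter of conductor dividing `𝔫 ∏_S w` and infinity type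
`(M, (mult w - 1) M)`, `M = n · lowest(wt) + deg(wt)`. [cite: Harder1987, §2] -/
theorem isGrossencharakter_centralEigensystem (ι : E ≃+* ℂ) {𝔫 : Ideal (𝓞 F)} (h𝔫 : 𝔫 ≠ 0)
    (hU : (principalCongruenceLevel n F 𝔫).comap (GLn.ofFinite n F) ≤ U)
    {S : Set (HeightOneSpectrum (𝓞 F))} (hS : S.Finite) {ξ : cohomology E F n wt U q} (hξ : ξ ≠ 0)
    (a : HeightOneSpectrum (𝓞 F) → E)
    (heig : ∀ w, w ∉ S → heckeOp E F n wt U q (heckeElement n F w n) ξ = a w • ξ) :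
    IsGrossencharakter (conductorOf 𝔫 hS) (fun _ => centralExponent n wt)
      (fun w => ((w.mult - 1 : ℕ) : ℤ) * centralExponent n wt) (fun w => ι (a w)) := by
  refine ⟨fun v hv => ?_, fun b c hb hc hcop hbc _ => ?_⟩
  · rw [map_ne_zero]
    exact centralEigenvalue_ne_zero hξ (heig v (not_mem_and_not_dvd_of_not_le hS hv).1)
  · -- the prime factors of `b` and `c` avoid `S` and `𝔫`
    have hcS : ∀ w : HeightOneSpectrum (𝓞 F), w.asIdeal ∣ Ideal.span {c} → w ∉ S ∧ ¬ w.asIdeal ∣ 𝔫 :=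
      fun w hw => not_mem_and_not_dvd_of_not_le hS (not_le_of_dvd_span_of_isCoprime hcop hw)
    have hbS : ∀ w : HeightOneSpectrum (𝓞 F), w.asIdeal ∣ Ideal.span {b} → w ∉ S ∧ ¬ w.asIdeal ∣ 𝔫 := by
      intro w hw
      refine not_mem_and_not_dvd_of_not_le hS fun hle => ?_
      refine not_le_of_dvd_span_of_isCoprime hcop (w := w) ?_ hle
      rw [Ideal.dvd_span_singleton]
      have hb' : b ∈ w.asIdeal := Ideal.dvd_span_singleton.1 hw
      have : b - (b - c) ∈ w.asIdeal := sub_mem hb' (hle hbc)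
      rwa [sub_sub_cancel] at this
    have hbc' : b - c ∈ 𝔫 := Ideal.mul_le_right hbc
    have key := centralEigensystem_idealPow_mul_eq h𝔫 hU S hξ a heig hb hc hbS hcS hbc'
    have key' := congrArg ι key
    rw [map_mul, map_mul, map_eigenvalueProd, map_eigenvalueProd, map_centralWeight,
      map_centralWeight] at key'
    rw [← prod_embeddings_zpow]
    -- `W(b/c) = W(b) / W(c)`
    have hWc : (∏ σ : F →+* ℂ, σ ((unitOf c hc : Fˣ) : F) ^ centralExponent n wt) ≠ 0 :=
      Finset.prod_ne_zero_iff.2 fun σ _ => zpow_ne_zero _ (by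
        rw [map_ne_zero]; exact (unitOf c hc).ne_zero)
    have hdiv : (∏ σ : F →+* ℂ, σ ((b : F) / c) ^ centralExponent n wt) =
        (∏ σ : F →+* ℂ, σ ((unitOf b hb : Fˣ) : F) ^ centralExponent n wt) /
          ∏ σ : F →+* ℂ, σ ((unitOf c hc : Fˣ) : F) ^ centralExponent n wt := by
      rw [← Finset.prod_div_distrib]
      refine Finset.prod_congr rfl fun σ _ => ?_
      rw [map_div₀, div_zpow]; rfl
    rw [hdiv, mul_div_assoc', eq_div_iff hWc, key']

end Literature.NumberTheory.Automorphic.ParallelWeight
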